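import Literature.Geometry.Kaehler.ComplexTorusSymmetricThetaInvolution
import Literature.Geometry.Kaehler.ComplexTorusPicardPoincareUniversal
import Literature.Geometry.Kaehler.ComplexTorusPicardPullback
import Literature.Geometry.Kaehler.ComplexTorusClassicalFactor
import Literature.Geometry.Kaehler.SiegelTorusThetaLineBundle
import Literature.Geometry.Kaehler.ComplexTorusTypeOfPolarization
import HarnessLib

/-!
# A positive line bundle is a translate of the pulled-back Siegel bundle: `L(H, χ) = t^* f^* L(H_Ω, χ₀)` in `Pic(X)`

Layer `Literature/Geometry/Kaehler`, namespace `Literature.Geometry.Kaehler.ComplexTorus`.  THEOREMS ONLY (no definition,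
no named fact, no instance).  Leaf F-C of the cell `hodgecm-mathlib` (U)-lane node U-aΘ L4 («a positive class has a power
which is the class of an AMPLE divisor»): the factor-of-automorphy bookkeeping which lets the level-three theta functions of
the Siegel torus be read as a Lefschetz family ON THE GIVEN TORUS for the cube of THE GIVEN positive class.

Let `X = E/Φ(ℤ^ι)` and `p = (H, χ) ∈ 𝒫(Λ)` with `E = Im H` a Riemann form (positive definite).  Then:

* `Factor.toPic_siegelFactor_eq` — on the Siegel torus `X_{(Ω,D)} = ℂ^g/(Dℤ^g ⊕ Ωℤ^g)` the classical factor `e[0;0]`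
  (`siegelFactor Ω`) has the class of `L(H_Ω, χ₀)`: it differs from the canonical factor by the coboundary of
  `e((π/2) B(v, v))` (★ `siegelFactor_eq_canonicalFactor_mul`, Lange (1.17));
* `IsRiemannForm.exists_toPic_eq_translate_pullback_siegelFactor` — **there are a Siegel datum `(Ω, D)` of the type of `E`,
  an isomorphism `f = (P, F) : X ⥲ X_{(Ω,D)}` of complex tori with `F^* E_Ω = E` (★ `exists_siegelTwoForm_pullback_eq_of_basis`,
  Lange–Birkenhake Prop. 8.1.1), and a vector `u ∈ E` such that `L(H, χ) = t_{ū}^* f^* [e[0;0]]` in `Pic(X)`**, i.e.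
  `AHData.toPic p` is the class of the factor `(λ, w) ↦ e[0;0](Pλ, F(w + u))`.  Proof: `f^*[e[0;0]] = L(F^*H_Ω, χ₀ ∘ P)`
  (★ `AHData.toPic_pullback`, Lemma 1.3.6) has the same NON-DEGENERATE first Chern class `E` as `L(H, χ)`, so the two
  classes differ by a translation (★ `Pic.nsForm_eq_iff_exists_translate_eq`, Cor. 1.4.13).
HC_CM is proved only modulo the 7 printed citations until rung 0 closes.

## References
* [Lange2023AbelianVarietiesComplex] H. Lange, *Abelian Varieties over the Complex Numbers* (2023), §1.3.3 Lemma 1.3.4 and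
  Lemma 1.3.6 (p. 31), §1.4.4 Cor. 1.4.13, §1.5.2 (1.17) (p. 49), §3.3.4 Exercise (4).
* [LangeBirkenhake1992] H. Lange, Ch. Birkenhake, *Complex Abelian Varieties* (1992), §8.1 Prop. 8.1.1.
-/

noncomputable section

open scoped Real
open Set Function Complex

namespace Literature.Geometry.Kaehler

namespace ComplexTorus

/-! ### The class of the Siegel factor `e[0;0]` is `L(H_Ω, χ₀)` -/

section Siegel

variable {g : ℕ} (Ω : Matrix (Fin g) (Fin g) ℂ) (d : Fin g → ℕ) (Φ' : (Fin g ⊕ Fin g → ℝ) ≃L[ℝ] (Fin g → ℂ))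

/-- **`[e[0;0]] = L(H_Ω, χ₀)` in `Pic(X_{(Ω,D)})`**: the classical factor of automorphy `e[0;0]` of the lattice
`Dℤ^g ⊕ Ωℤ^g` is equivalent to the canonical factor `a_{(H_Ω, χ₀)}` — they differ by the coboundary of the entire unit
`v ↦ e((π/2) B_Ω(v, v))` (Lange (1.17)). [cite: Lange2023AbelianVarietiesComplex, §1.5.2 (1.17) (p. 49) and §3.3.4 Exercise (4)] -/
theorem Factor.toPic_siegelFactor_eq (hΦ' : ∀ v i, Φ' v i = (d i : ℂ) * (v (Sum.inl i) : ℂ) + ∑ j, Ω i j * (v (Sum.inr j) : ℂ))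
    (hΩ : ∀ i j, Ω i j = Ω j i) (hpos : (Matrix.of fun i j ↦ (Ω i j).im).PosDef) :
    Factor.toPic ⟨siegelFactor Ω, isFactor_siegelFactor_typeD Ω d Φ' hΦ' hΩ⟩ =
      AHData.toPic ⟨siegelTwoForm d Φ', siegelChar d, isNSForm_siegelTwoForm Ω d Φ' hΦ' hΩ hpos,
        isSemicharacter_siegelChar d Φ'⟩ := by
  rw [AHData.toPic_apply, Factor.toPic_eq_toPic_iff]
  refine ⟨fun v ↦ cexp (π / 2 * siegelBilin Ω v v), differentiable_cexp_half_bilin (siegelBilin Ω),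
    fun v ↦ Complex.exp_ne_zero _, fun n v ↦ ?_⟩
  rw [AHData.toFactor_apply]
  change canonicalFactor Φ' (siegelTwoForm d Φ') (siegelChar d) n v * cexp (π / 2 * siegelBilin Ω v v) =
    siegelFactor Ω n v * cexp (π / 2 * siegelBilin Ω (v + latticeVec Φ' n) (v + latticeVec Φ' n))
  rw [siegelFactor_eq_canonicalFactor_mul Ω d Φ' hΦ' hΩ hpos n v, mul_assoc,
    inv_mul_cancel₀ (Complex.exp_ne_zero _), mul_one]

end Siegel

/-! ### `L(H, χ) = t_ū^* f^* [e[0;0]]` for a positive `L(H, χ)` -/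

section Positive

variable {ι : Type} [Fintype ι] [DecidableEq ι] {E : Type} [NormedAddCommGroup E] [NormedSpace ℂ E]
  [FiniteDimensional ℂ E] (Φ : (ι → ℝ) ≃L[ℝ] E)

variable {Φ} in
omit [Fintype ι] [DecidableEq ι] [FiniteDimensional ℂ E] in
/-- A Riemann form is non-degenerate: `E(u, ·) = 0` forces `u = 0` (positivity `E(iu, u) > 0` for `u ≠ 0`; ★ `twoForm_swap`).
[cite: Lange2023AbelianVarietiesComplex, §2.1.1 (p. 76)] -/
theorem IsRiemannForm.eq_zero_of_forall_apply_eq_zero {η : E [⋀^Fin 2]→L[ℝ] ℝ} (hη : IsRiemannForm Φ η)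
    {u : E} (hu : ∀ v, η ![u, v] = 0) : u = 0 :=
  hη.eq_zero_of_apply_eq_zero (by rw [twoForm_swap, hu, neg_zero])

/-- **A positive line bundle is a translate of the pulled-back Siegel bundle.**  For `p = (H, χ) ∈ 𝒫(Λ)` with `E = Im H` a
Riemann form on `X = E/Φ(ℤ^ι)` there are: a Siegel datum `(Ω, D)` (`Ω = ᵗΩ`, `Im Ω ≻ 0`, `dᵢ ≥ 1`) with its period
isomorphism `Φ'`, mutually inverse integer matrices `P`, `Q` and mutually inverse `ℂ`-linear maps `F`, `G` forming an
isomorphism of complex tori `X ⥲ X_{(Ω,D)}` (`Φ' ∘ P = F ∘ Φ`) along which `F^* E_Ω = E`, and a vector `u`, such that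
**`L(H, χ) = t_{ū}^* f^* [e[0;0]]`**: `AHData.toPic p` is the class of the factor `(λ, w) ↦ e[0;0](Pλ, F(w + u))`.
(Lange–Birkenhake Prop. 8.1.1 for the isomorphism; Lemma 1.3.6 `f^*[e[0;0]] = L(F^*H_Ω, χ₀ ∘ P)`; Cor. 1.4.13: two classes
with the same non-degenerate `c₁` differ by a translation.) [cite: LangeBirkenhake1992, §8.1 Prop. 8.1.1]
[cite: Lange2023AbelianVarietiesComplex, §1.3.3 Lemma 1.3.4 and Lemma 1.3.6 (p. 31), §1.4.4 Cor. 1.4.13] -/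
theorem IsRiemannForm.exists_toPic_eq_translate_pullback_siegelFactor (p : AHData Φ) (hp : IsRiemannForm Φ p.form) :
    ∃ (g : ℕ) (d : Fin g → ℕ) (Ω : Matrix (Fin g) (Fin g) ℂ) (Φ' : (Fin g ⊕ Fin g → ℝ) ≃L[ℝ] (Fin g → ℂ))
      (P : Matrix (Fin g ⊕ Fin g) ι ℤ) (Q : Matrix ι (Fin g ⊕ Fin g) ℤ) (F : E →L[ℂ] (Fin g → ℂ))
      (G : (Fin g → ℂ) →L[ℂ] E) (hΩ : ∀ i j, Ω i j = Ω j i)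
      (hΦ' : ∀ v i, Φ' v i = (d i : ℂ) * (v (Sum.inl i) : ℂ) + ∑ j, Ω i j * (v (Sum.inr j) : ℂ))
      (hPF : ∀ x, Φ' ((P.map (Int.cast : ℤ → ℝ)).mulVec x) = F (Φ x)) (u : E),
      (∀ i, 0 < d i) ∧ (Matrix.of fun i j ↦ (Ω i j).im).PosDef ∧ P * Q = 1 ∧ Q * P = 1 ∧
      (∀ v, G (F v) = v) ∧ (∀ w, F (G w) = w) ∧ pullbackForm F (siegelTwoForm d Φ') = p.form ∧
      AHData.toPic p =
        (Factor.translate Φ u (Factor.pullback Φ Φ' hPF ⟨siegelFactor Ω, isFactor_siegelFactor_typeD Ω d Φ' hΦ' hΩ⟩)).toPic := by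
  -- a symplectic basis of type `D` for `E`, and the Siegel normal form with its decomposition
  obtain ⟨g, d, ⟨-, b, h₁₁, h₂₂, h₁₂⟩, hd⟩ := hp.exists_isPolarizationType
  obtain ⟨Ω, Φ', P, Q, F, G, hΩ, hpos, hΦ', hPQ, hQP, hGF, hFG, hPF, hpull, -⟩ :=
    exists_siegelTwoForm_pullback_eq_of_basis Φ hp b d hd h₁₁ h₂₂ h₁₂
  -- the pulled-back Siegel bundle `f^* L(H_Ω, χ₀)` and its first Chern class `F^* E_Ω = E`
  set f₀ : Factor Φ := Factor.pullback Φ Φ' hPF ⟨siegelFactor Ω, isFactor_siegelFactor_typeD Ω d Φ' hΦ' hΩ⟩ with hf₀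
  have hclass : f₀.toPic = AHData.toPic (AHData.pullback Φ Φ' hPF ⟨siegelTwoForm d Φ', siegelChar d,
      isNSForm_siegelTwoForm Ω d Φ' hΦ' hΩ hpos, isSemicharacter_siegelChar d Φ'⟩) := by
    rw [hf₀, ← Pic.pullback_toPic, Factor.toPic_siegelFactor_eq Ω d Φ' hΦ' hΩ hpos, AHData.toPic_pullback]
  have hns : Pic.nsForm f₀.toPic = p.form := by
    rw [hclass, AHData.nsForm_toPic, AHData.pullback_form, hpull]
  -- `E` is non-degenerate, so `L(H, χ)` and `f^* L(H_Ω, χ₀)` differ by a translation (Cor. 1.4.13)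
  have hnd : ∀ w : E, (∀ v, Pic.nsForm f₀.toPic ![w, v] = 0) → w = 0 := fun w hw ↦
    hp.eq_zero_of_forall_apply_eq_zero fun v ↦ by rw [← hns]; exact hw v
  have hsame : Pic.nsForm (AHData.toPic p) = Pic.nsForm f₀.toPic := by rw [AHData.nsForm_toPic, hns]
  obtain ⟨t, ht⟩ := (Pic.nsForm_eq_iff_exists_translate_eq Φ hnd (AHData.toPic p)).1 hsame
  obtain ⟨u, rfl⟩ := cover_surjective Φ t
  refine ⟨g, d, Ω, Φ', P, Q, F, G, hΩ, hΦ', hPF, u, hd, hpos, hPQ, hQP, hGF, hFG, hpull, ?_⟩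
  rw [ht, Pic.translate_cover_toPic]

end Positive

end ComplexTorus

end Literature.Geometry.Kaehler

end
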